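import Summits.CriticalPhenomena.PercolationContinuityZ3.Theorems.PercNearOneGluingNoHeavyQuantFarSunTKReveal
import Summits.CriticalPhenomena.PercolationContinuityZ3.Theorems.PercNearOneGluingNoHeavyQuantFarSunLawSums
import Summits.CriticalPhenomena.PercolationContinuityZ3.Theorems.PercNearOneGluingNoHeavyQuantFarSunCondition
import HarnessLib

/-!
# FAR beyond trees: the certificate `T_K` — the TWO-CHAIN functional: `sunLaw = tcE`, and the two-copy expectation of the
# symmetrised certificate weight is non-negative (law-level symmetrisation)

builds on p205010 (kernel theorem, internal audit signed; external expert review pending)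

Support file (`--supports stmt-CriticalPhenomena-4575`), seat `prim-cert-1` (gen 23); memo `prim-cert-1/FROM-prim-cert-1-g23-SUNFAR-ALL-K.md` §2.
* `TK.sunLaw_eq_tcE` — **the independent two-chain form of the sun law**: `sunLaw K g h Φ = tcE K g h 𝟙[Φ]` (from gen 20's gap form
  `HairyCycle.sunLaw_eq_gap_form`: nonempty gaps carry the product weights `aL l · bM l'`, and all `(l, l')` with `l' ≤ l` see every hair).
* `TK.aL_nonneg`, `TK.bM_nonneg`, `TK.sum_aL`, `TK.sum_bM` — the two-chain weights are probability vectors for `g ∈ [0,1]`.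
* `TK.HH_nonneg` — for every `l, m ≤ K+1`, `l', m' ≤ K`: `0 ≤ Σ_{Q,Q'} hairW Q · hairW Q' · [W(Q∩cov l l', Q'∩cov m m') + W(Q∩cov l m', Q'∩cov m l')]`
  (`TK.reveal_nonneg` with the copies / the two pairs exchanged as needed).
* **`TK.tcE2_Wcert_nonneg`** — `0 ≤ tcE2 K g h W` for `g, h ∈ [0,1]`, `4 ≤ K`: exchange the suffix variables `l' ↔ m'` of the two copies
  (the two-chain law is a product law) and average — the M-swap symmetrisation of memo §2.
No sorries; standard axioms.  Elementary [this work].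
-/

noncomputable section

namespace Summit.CriticalPhenomena.PercolationContinuityZ3.Theorems.HairyCycle

namespace TK

open Finset

variable {K : ℕ}

/-! ## The two-chain weights -/

/-- `aL l ≥ 0` for `g ∈ [0,1]`. [this work] -/
theorem aL_nonneg {g : ℕ → ℝ} (hg : ∀ m, m ≤ K → 0 ≤ g m ∧ g m ≤ 1) (l : ℕ) : 0 ≤ aL K g l := by
  unfold aL
  have hA : ∀ i, i ≤ K + 1 → 0 ≤ arcA g i := fun i hi =>
    Finset.prod_nonneg fun m hm => (hg m (by rw [Finset.mem_range] at hm; omega)).1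
  split_ifs with hl
  · rw [arcA_succ]
    have h1 := (hg l hl).2
    nlinarith [hA l (by omega), (hg l hl).1]
  · exact hA (K + 1) le_rfl

/-- `bM l' ≥ 0` for `g ∈ [0,1]` and `l' ≤ K`. [this work] -/
theorem bM_nonneg {g : ℕ → ℝ} (hg : ∀ m, m ≤ K → 0 ≤ g m ∧ g m ≤ 1) {l' : ℕ} (hl' : l' ≤ K) : 0 ≤ bM K g l' := by
  unfold bM
  have hB : ∀ i, 0 ≤ arcB K g i := fun i => Finset.prod_nonneg fun m hm => (hg m (by rw [Finset.mem_Ico] at hm; omega)).1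
  split_ifs with h0
  · exact hB 1
  · rw [arcB_eq_mul g hl']
    have h1 := (hg l' hl').2
    nlinarith [hB (l' + 1), (hg l' hl').1]

/-- `Σ_{l ≤ K+1} aL l = 1` (telescope, `α_0 = 1`). [this work] -/
theorem sum_aL (g : ℕ → ℝ) : ∑ l ∈ range (K + 2), aL K g l = 1 := by
  rw [Finset.sum_range_succ]
  have h1 : ∑ l ∈ range (K + 1), aL K g l = ∑ l ∈ range (K + 1), (arcA g l - arcA g (l + 1)) :=
    Finset.sum_congr rfl fun l hl => by rw [Finset.mem_range] at hl; unfold aL; rw [if_pos (by omega)]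
  rw [h1, Finset.sum_range_sub', arcA_zero]
  unfold aL; rw [if_neg (by omega)]; ring

/-- `Σ_{l' ≤ K} bM l' = 1` (telescope, `β_{K+1} = 1`). [this work] -/
theorem sum_bM (g : ℕ → ℝ) : ∑ l' ∈ range (K + 1), bM K g l' = 1 := by
  rw [Finset.sum_range_succ']
  have h1 : ∑ l' ∈ range K, bM K g (l' + 1) = ∑ l' ∈ range K, (arcB K g (l' + 1 + 1) - arcB K g (l' + 1)) :=
    Finset.sum_congr rfl fun l' _ => by unfold bM; rw [if_neg (by omega)]
  rw [h1, Finset.sum_range_sub (fun i => arcB K g (i + 1)), arcB_top]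
  unfold bM; rw [if_pos rfl]; ring

/-! ## `sunLaw = tcE` -/

/-- For `l' ≤ l` every hair index is covered: `Q ∩ cov K l l' = Q` (`Q ⊆ range K`). [this work] -/
theorem inter_cov_of_le {Q : Finset ℕ} (hQ : Q ⊆ range K) {l l' : ℕ} (h : l' ≤ l) : Q ∩ cov K l l' = Q := by
  ext k; rw [Finset.mem_inter, mem_cov]
  constructor
  · exact fun hk => hk.1
  · intro hk; exact ⟨hk, Finset.mem_range.1 (hQ hk), by omega⟩

open scoped Classical in
/-- **`sunLaw` in the independent two-chain form**: `sunLaw K g h Φ = tcE K g h 𝟙[Φ]` (every real `g`, `h`). [this work] -/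
theorem sunLaw_eq_tcE (g h : ℕ → ℝ) (Φ : Finset ℕ → Prop) :
    sunLaw K g h Φ = tcE K g h (fun R => if Φ R then 1 else 0) := by
  classical
  rw [sunLaw_eq_gap_form]
  unfold tcE
  refine Finset.sum_congr rfl fun Q hQ => ?_
  rw [Finset.mem_powerset] at hQ
  -- split the `(l, l')` double sum into `l < l'` (nonempty gaps) and `l' ≤ l` (everything covered)
  have hsplit : ∑ l ∈ range (K + 2), ∑ l' ∈ range (K + 1), hairW K h Q * aL K g l * bM K g l' * (if Φ (Q ∩ cov K l l') then 1 else 0) =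
      ∑ p ∈ (range (K + 2) ×ˢ range (K + 1)).filter (fun p : ℕ × ℕ => p.1 < p.2),
          hairW K h Q * aL K g p.1 * bM K g p.2 * (if Φ (Q ∩ cov K p.1 p.2) then 1 else 0) +
        ∑ p ∈ (range (K + 2) ×ˢ range (K + 1)).filter (fun p : ℕ × ℕ => ¬ p.1 < p.2),
          hairW K h Q * aL K g p.1 * bM K g p.2 * (if Φ Q then 1 else 0) := by
    rw [← Finset.sum_product (s := range (K + 2)) (t := range (K + 1))
      (f := fun p : ℕ × ℕ => hairW K h Q * aL K g p.1 * bM K g p.2 * (if Φ (Q ∩ cov K p.1 p.2) then 1 else 0)),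
      ← Finset.sum_filter_add_sum_filter_not _ (fun p : ℕ × ℕ => p.1 < p.2)]
    congr 1
    refine Finset.sum_congr rfl fun p hp => ?_
    rw [Finset.mem_filter] at hp
    rw [inter_cov_of_le hQ (not_lt.1 hp.2)]
  rw [hsplit]
  -- the gap part matches term by term
  have hgap : ∑ p ∈ (range (K + 2) ×ˢ range (K + 1)).filter (fun p : ℕ × ℕ => p.1 < p.2),
      hairW K h Q * aL K g p.1 * bM K g p.2 * (if Φ (Q ∩ cov K p.1 p.2) then 1 else 0) =
      hairW K h Q * ∑ p ∈ (arcIx K).filter (fun p => p.1 < p.2 ∧ p.2 ≤ K),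
        (arcA g p.1 - arcA g (p.1 + 1)) * (arcB K g (p.2 + 1) - arcB K g p.2) * (if Φ (Q ∩ cov K p.1 p.2) then 1 else 0) := by
    have hset : (range (K + 2) ×ˢ range (K + 1)).filter (fun p : ℕ × ℕ => p.1 < p.2) = (arcIx K).filter (fun p => p.1 < p.2 ∧ p.2 ≤ K) := by
      ext p
      rw [Finset.mem_filter, Finset.mem_product, Finset.mem_range, Finset.mem_range, Finset.mem_filter, mem_arcIx]
      omega
    rw [hset, Finset.mul_sum]
    refine Finset.sum_congr rfl fun p hp => ?_
    rw [Finset.mem_filter, mem_arcIx] at hp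
    unfold aL bM
    rw [if_pos (by omega), if_neg (by omega)]
    ring
  -- the full part: constant summand; its total weight is `1 −` the gap mass
  have hfull : ∑ p ∈ (range (K + 2) ×ˢ range (K + 1)).filter (fun p : ℕ × ℕ => ¬ p.1 < p.2),
      hairW K h Q * aL K g p.1 * bM K g p.2 * (if Φ Q then 1 else 0) =
      hairW K h Q * ((arcA g (K + 1) + ∑ l ∈ range (K + 1), (arcA g l - arcA g (l + 1)) * arcB K g (l + 1)) * (if Φ Q then 1 else 0)) := by
    have hw1 : ∑ p ∈ (range (K + 2) ×ˢ range (K + 1)).filter (fun p : ℕ × ℕ => ¬ p.1 < p.2), aL K g p.1 * bM K g p.2 =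
        1 - ∑ p ∈ (range (K + 2) ×ˢ range (K + 1)).filter (fun p : ℕ × ℕ => p.1 < p.2), aL K g p.1 * bM K g p.2 := by
      have htot : ∑ p ∈ range (K + 2) ×ˢ range (K + 1), aL K g p.1 * bM K g p.2 = 1 := by
        rw [Finset.sum_product, ← Finset.sum_mul_sum, sum_aL, sum_bM, one_mul]
      have := Finset.sum_filter_add_sum_filter_not (range (K + 2) ×ˢ range (K + 1)) (fun p : ℕ × ℕ => p.1 < p.2)
        (fun p => aL K g p.1 * bM K g p.2)
      linarith
    have hw2 : ∑ p ∈ (range (K + 2) ×ˢ range (K + 1)).filter (fun p : ℕ × ℕ => p.1 < p.2), aL K g p.1 * bM K g p.2 =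
        ∑ p ∈ (arcIx K).filter (fun p => p.1 < p.2 ∧ p.2 ≤ K), (arcA g p.1 - arcA g (p.1 + 1)) * (arcB K g (p.2 + 1) - arcB K g p.2) := by
      have hset : (range (K + 2) ×ˢ range (K + 1)).filter (fun p : ℕ × ℕ => p.1 < p.2) = (arcIx K).filter (fun p => p.1 < p.2 ∧ p.2 ≤ K) := by
        ext p
        rw [Finset.mem_filter, Finset.mem_product, Finset.mem_range, Finset.mem_range, Finset.mem_filter, mem_arcIx]
        omega
      rw [hset]
      refine Finset.sum_congr rfl fun p hp => ?_
      rw [Finset.mem_filter, mem_arcIx] at hp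
      unfold aL bM
      rw [if_pos (by omega), if_neg (by omega)]
    have hconst : ∑ p ∈ (range (K + 2) ×ˢ range (K + 1)).filter (fun p : ℕ × ℕ => ¬ p.1 < p.2),
        hairW K h Q * aL K g p.1 * bM K g p.2 * (if Φ Q then 1 else 0) =
        hairW K h Q * (∑ p ∈ (range (K + 2) ×ˢ range (K + 1)).filter (fun p : ℕ × ℕ => ¬ p.1 < p.2), aL K g p.1 * bM K g p.2) *
          (if Φ Q then 1 else 0) := by
      rw [Finset.mul_sum, Finset.sum_mul]
      refine Finset.sum_congr rfl fun p _ => by ring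
    have hm : 1 - ∑ p ∈ (arcIx K).filter (fun p => p.1 < p.2 ∧ p.2 ≤ K), (arcA g p.1 - arcA g (p.1 + 1)) * (arcB K g (p.2 + 1) - arcB K g p.2) =
        arcA g (K + 1) + ∑ l ∈ range (K + 1), (arcA g l - arcA g (l + 1)) * arcB K g (l + 1) := by
      have := gap_masses_total (K := K) g
      linarith
    rw [hconst, hw1, hw2, hm]
    ring
  rw [hgap, hfull]
  ring

/-! ## The hair-averaged pair sums `HH` and their non-negativity -/

open scoped Classical in
/-- `hw (range K) h = hairW K h`. [this work] -/
theorem hw_range_eq (h : ℕ → ℝ) (Q : Finset ℕ) : hw (range K) h Q = hairW K h Q := by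
  unfold hw hairW
  refine Finset.prod_congr rfl fun k _ => ?_
  congr

/-- `corePS` without split hairs. [this work] -/
theorem corePS_empty (A1 B1 A2 B2 HA HB : Finset ℕ) :
    corePS A1 B1 A2 B2 K HA HB ∅ = Wcert K (A1 ∩ HA) (B1 ∩ HB) + Wcert K (A2 ∩ HA) (B2 ∩ HB) := by
  unfold corePS
  rw [Finset.powerset_empty, Finset.sum_singleton, Finset.sdiff_self, Finset.union_empty, Finset.union_empty]

/-- The hair-averaged double pair sum at `(l, m, l', m')` equals `Ω` of the four arcsets with all hairs random. [this work] -/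
theorem HH_eq_Omega (h : ℕ → ℝ) (l m l' m' : ℕ) :
    ∑ Q ∈ (range K).powerset, ∑ Q' ∈ (range K).powerset, hairW K h Q * hairW K h Q' *
      ((Wcert K (Q ∩ cov K l l') (Q' ∩ cov K m m') : ℝ) + (Wcert K (Q ∩ cov K l m') (Q' ∩ cov K m l') : ℝ)) =
    Omega (cov K l l') (cov K m m') (cov K l m') (cov K m l') K h (range K) ∅ ∅ := by
  unfold Omega
  refine Finset.sum_congr rfl fun Q _ => Finset.sum_congr rfl fun Q' _ => ?_
  rw [hw_range_eq, hw_range_eq, Finset.empty_union, Finset.empty_union, corePS_empty, Finset.inter_comm Q, Finset.inter_comm Q',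
    Finset.inter_comm Q, Finset.inter_comm Q']
  push_cast; ring

/-- `Ω` with the two pairs exchanged. [this work] -/
theorem Omega_pairs_comm (A1 B1 A2 B2 : Finset ℕ) (h : ℕ → ℝ) (S Z T : Finset ℕ) :
    Omega A1 B1 A2 B2 K h S Z T = Omega A2 B2 A1 B1 K h S Z T := by
  unfold Omega corePS
  refine Finset.sum_congr rfl fun Q _ => Finset.sum_congr rfl fun Q' _ => ?_
  congr 2
  exact Finset.sum_congr rfl fun J _ => add_comm _ _

/-- `Ω` (no split hairs) with the two copies exchanged. [this work] -/
theorem Omega_copies_comm (A1 B1 A2 B2 : Finset ℕ) (h : ℕ → ℝ) (S Z : Finset ℕ) :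
    Omega A1 B1 A2 B2 K h S Z ∅ = Omega B1 A1 B2 A2 K h S Z ∅ := by
  unfold Omega
  rw [Finset.sum_comm]
  refine Finset.sum_congr rfl fun Q _ => Finset.sum_congr rfl fun Q' _ => ?_
  rw [corePS_empty, corePS_empty, Wcert_comm (A1 ∩ _), Wcert_comm (A2 ∩ _)]
  ring

/-- **Non-negativity of the hair-averaged double pair sums** for all `l, m` and `l', m' ≤ K` (`h ∈ [0,1]`, `4 ≤ K`). [this work] -/
theorem HH_nonneg (hK : 4 ≤ K) {h : ℕ → ℝ} (hh : ∀ k, k < K → 0 ≤ h k ∧ h k ≤ 1) (l m : ℕ) {l' m' : ℕ} (hl' : l' ≤ K) (hm' : m' ≤ K) :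
    0 ≤ ∑ Q ∈ (range K).powerset, ∑ Q' ∈ (range K).powerset, hairW K h Q * hairW K h Q' *
      ((Wcert K (Q ∩ cov K l l') (Q' ∩ cov K m m') : ℝ) + (Wcert K (Q ∩ cov K l m') (Q' ∩ cov K m l') : ℝ)) := by
  rw [HH_eq_Omega]
  have R : ∀ {L M α β : ℕ}, M ≤ L → α ≤ β → β ≤ K → 0 ≤ Omega (cov K L α) (cov K M β) (cov K L β) (cov K M α) K h (range K) ∅ ∅ :=
    fun hML hab hbK => reveal_nonneg hK hh hML hab hbK (range K) ∅ ∅ (subset_refl _) (Finset.empty_subset _) (Finset.empty_subset _)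
      (Finset.disjoint_empty_right _) (Finset.disjoint_empty_right _) (Finset.disjoint_empty_right _)
  rcases le_total m l with hml | hlm
  · rcases le_total l' m' with h1 | h1
    · exact R hml h1 hm'
    · rw [Omega_pairs_comm]; exact R hml h1 hl'
  · rw [Omega_copies_comm]
    rcases le_total m' l' with h1 | h1
    · exact R hlm h1 hl'
    · rw [Omega_pairs_comm]; exact R hlm h1 hm'

/-! ## The two-copy expectation of the symmetrised weight is non-negative -/

/-- Reordering a six-fold sum: the two hair sums innermost. [this work] -/
theorem sum_reorder6 {α β γ : Type*} (P : Finset α) (R2 : Finset β) (R1 : Finset γ) (f : α → α → β → γ → β → γ → ℝ) :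
    ∑ Q ∈ P, ∑ Q' ∈ P, ∑ l ∈ R2, ∑ l' ∈ R1, ∑ m ∈ R2, ∑ m' ∈ R1, f Q Q' l l' m m' =
      ∑ l ∈ R2, ∑ l' ∈ R1, ∑ m ∈ R2, ∑ m' ∈ R1, ∑ Q ∈ P, ∑ Q' ∈ P, f Q Q' l l' m m' := by
  calc ∑ Q ∈ P, ∑ Q' ∈ P, ∑ l ∈ R2, ∑ l' ∈ R1, ∑ m ∈ R2, ∑ m' ∈ R1, f Q Q' l l' m m'
      = ∑ Q ∈ P, ∑ l ∈ R2, ∑ Q' ∈ P, ∑ l' ∈ R1, ∑ m ∈ R2, ∑ m' ∈ R1, f Q Q' l l' m m' :=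
        Finset.sum_congr rfl fun _ _ => Finset.sum_comm
    _ = ∑ l ∈ R2, ∑ Q ∈ P, ∑ Q' ∈ P, ∑ l' ∈ R1, ∑ m ∈ R2, ∑ m' ∈ R1, f Q Q' l l' m m' := Finset.sum_comm
    _ = ∑ l ∈ R2, ∑ Q ∈ P, ∑ l' ∈ R1, ∑ Q' ∈ P, ∑ m ∈ R2, ∑ m' ∈ R1, f Q Q' l l' m m' :=
        Finset.sum_congr rfl fun _ _ => Finset.sum_congr rfl fun _ _ => Finset.sum_comm
    _ = ∑ l ∈ R2, ∑ l' ∈ R1, ∑ Q ∈ P, ∑ Q' ∈ P, ∑ m ∈ R2, ∑ m' ∈ R1, f Q Q' l l' m m' :=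
        Finset.sum_congr rfl fun _ _ => Finset.sum_comm
    _ = ∑ l ∈ R2, ∑ l' ∈ R1, ∑ Q ∈ P, ∑ m ∈ R2, ∑ Q' ∈ P, ∑ m' ∈ R1, f Q Q' l l' m m' :=
        Finset.sum_congr rfl fun _ _ => Finset.sum_congr rfl fun _ _ => Finset.sum_congr rfl fun _ _ => Finset.sum_comm
    _ = ∑ l ∈ R2, ∑ l' ∈ R1, ∑ m ∈ R2, ∑ Q ∈ P, ∑ Q' ∈ P, ∑ m' ∈ R1, f Q Q' l l' m m' :=
        Finset.sum_congr rfl fun _ _ => Finset.sum_congr rfl fun _ _ => Finset.sum_comm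
    _ = ∑ l ∈ R2, ∑ l' ∈ R1, ∑ m ∈ R2, ∑ Q ∈ P, ∑ m' ∈ R1, ∑ Q' ∈ P, f Q Q' l l' m m' :=
        Finset.sum_congr rfl fun _ _ => Finset.sum_congr rfl fun _ _ => Finset.sum_congr rfl fun _ _ =>
          Finset.sum_congr rfl fun _ _ => Finset.sum_comm
    _ = ∑ l ∈ R2, ∑ l' ∈ R1, ∑ m ∈ R2, ∑ m' ∈ R1, ∑ Q ∈ P, ∑ Q' ∈ P, f Q Q' l l' m m' :=
        Finset.sum_congr rfl fun _ _ => Finset.sum_congr rfl fun _ _ => Finset.sum_congr rfl fun _ _ => Finset.sum_comm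

/-- Relabelling the suffix variables `l' ↔ m'` inside a six-fold sum. [this work] -/
theorem sum_relabel6 {α β γ : Type*} (P : Finset α) (R2 : Finset β) (R1 : Finset γ) (f : α → α → β → γ → β → γ → ℝ) :
    ∑ Q ∈ P, ∑ Q' ∈ P, ∑ l ∈ R2, ∑ l' ∈ R1, ∑ m ∈ R2, ∑ m' ∈ R1, f Q Q' l l' m m' =
      ∑ Q ∈ P, ∑ Q' ∈ P, ∑ l ∈ R2, ∑ l' ∈ R1, ∑ m ∈ R2, ∑ m' ∈ R1, f Q Q' l m' m l' := by
  refine Finset.sum_congr rfl fun _ _ => Finset.sum_congr rfl fun _ _ => Finset.sum_congr rfl fun _ _ => ?_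
  calc ∑ l' ∈ R1, ∑ m ∈ R2, ∑ m' ∈ R1, f _ _ _ l' m m'
      = ∑ l' ∈ R1, ∑ m' ∈ R1, ∑ m ∈ R2, f _ _ _ l' m m' := Finset.sum_congr rfl fun _ _ => Finset.sum_comm
    _ = ∑ m' ∈ R1, ∑ l' ∈ R1, ∑ m ∈ R2, f _ _ _ l' m m' := Finset.sum_comm
    _ = ∑ m' ∈ R1, ∑ m ∈ R2, ∑ l' ∈ R1, f _ _ _ l' m m' := Finset.sum_congr rfl fun _ _ => Finset.sum_comm

/-- **THE LAW-LEVEL SYMMETRISATION**: for `g, h ∈ [0,1]` and `4 ≤ K`, the two-copy two-chain expectation of the symmetrised certificate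
weight is non-negative: `0 ≤ tcE2 K g h W`. [this work] -/
theorem tcE2_Wcert_nonneg (hK : 4 ≤ K) {g h : ℕ → ℝ} (hg : ∀ m, m ≤ K → 0 ≤ g m ∧ g m ≤ 1) (hh : ∀ k, k < K → 0 ≤ h k ∧ h k ≤ 1) :
    0 ≤ tcE2 K g h (fun R R' => (Wcert K R R' : ℝ)) := by
  have e1 : tcE2 K g h (fun R R' => (Wcert K R R' : ℝ)) =
      ∑ l ∈ range (K + 2), ∑ l' ∈ range (K + 1), ∑ m ∈ range (K + 2), ∑ m' ∈ range (K + 1),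
        ∑ Q ∈ (range K).powerset, ∑ Q' ∈ (range K).powerset,
          hairW K h Q * hairW K h Q' * (aL K g l * bM K g l' * (aL K g m * bM K g m')) * (Wcert K (Q ∩ cov K l l') (Q' ∩ cov K m m') : ℝ) := by
    unfold tcE2; exact sum_reorder6 _ _ _ _
  have e2 : tcE2 K g h (fun R R' => (Wcert K R R' : ℝ)) =
      ∑ l ∈ range (K + 2), ∑ l' ∈ range (K + 1), ∑ m ∈ range (K + 2), ∑ m' ∈ range (K + 1),
        ∑ Q ∈ (range K).powerset, ∑ Q' ∈ (range K).powerset,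
          hairW K h Q * hairW K h Q' * (aL K g l * bM K g l' * (aL K g m * bM K g m')) * (Wcert K (Q ∩ cov K l m') (Q' ∩ cov K m l') : ℝ) := by
    unfold tcE2
    rw [sum_relabel6]
    rw [sum_reorder6]
    refine Finset.sum_congr rfl fun l _ => Finset.sum_congr rfl fun l' _ => Finset.sum_congr rfl fun m _ =>
      Finset.sum_congr rfl fun m' _ => Finset.sum_congr rfl fun Q _ => Finset.sum_congr rfl fun Q' _ => by ring
  have e3 : 2 * tcE2 K g h (fun R R' => (Wcert K R R' : ℝ)) =
      ∑ l ∈ range (K + 2), ∑ l' ∈ range (K + 1), ∑ m ∈ range (K + 2), ∑ m' ∈ range (K + 1),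
        (aL K g l * bM K g l' * (aL K g m * bM K g m')) *
        ∑ Q ∈ (range K).powerset, ∑ Q' ∈ (range K).powerset, hairW K h Q * hairW K h Q' *
          ((Wcert K (Q ∩ cov K l l') (Q' ∩ cov K m m') : ℝ) + (Wcert K (Q ∩ cov K l m') (Q' ∩ cov K m l') : ℝ)) := by
    rw [two_mul]
    nth_rewrite 1 [e1]
    rw [e2]
    simp only [← Finset.sum_add_distrib, Finset.mul_sum]
    refine Finset.sum_congr rfl fun l _ => Finset.sum_congr rfl fun l' _ => Finset.sum_congr rfl fun m _ =>
      Finset.sum_congr rfl fun m' _ => Finset.sum_congr rfl fun Q _ => Finset.sum_congr rfl fun Q' _ => by ring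
  have h2 : 0 ≤ 2 * tcE2 K g h (fun R R' => (Wcert K R R' : ℝ)) := by
    rw [e3]
    refine Finset.sum_nonneg fun l _ => Finset.sum_nonneg fun l' hl' => Finset.sum_nonneg fun m _ => Finset.sum_nonneg fun m' hm' => ?_
    rw [Finset.mem_range] at hl' hm'
    exact mul_nonneg (mul_nonneg (mul_nonneg (aL_nonneg hg l) (bM_nonneg hg (by omega)))
      (mul_nonneg (aL_nonneg hg m) (bM_nonneg hg (by omega)))) (HH_nonneg hK hh l m (by omega) (by omega))
  linarith

end TK

end Summit.CriticalPhenomena.PercolationContinuityZ3.Theorems.HairyCycle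

end
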